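import Literature.AlgebraicGeometry.Andre1996.MonodromyInvariantMotivatedClasses
import Literature.AlgebraicGeometry.Motives.ProjectiveOfGeneratingSections
import Literature.AlgebraicGeometry.HodgeTheory.HyperplaneSectionMonodromySmoothLocus
import Summits.HodgeConjecture.HodgeConjecture.Theorems.Ring2HypothesesDescentStandardBSurjective
import Summits.HodgeConjecture.HodgeConjecture.Theorems.Ring2AbelianAllLefschetzPencilsGraded
import HarnessLib

/-!
# Ring 2 hypotheses, descent face — FINITE ÉTALE BASE CHANGE ON THE b05 AXIS: connected finite étale covers of smooth
# projective varieties are smooth projective, base-changed families keep smooth projective total spaces, compact abelian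
# pencils pull back to compact abelian pencils, and `B⋆` of a pencil's total space DESCENDS from the pulled-back pencil

research route conditional on HC_CM; not a corollary; Q11.4-sentence-2 already refuted in dim ≥ 3.
Cell `pub-hodge-ring2` (Hodge ladder STAGE 3), seat `ring2-b05` (binder row b05
`Ring2.Hypotheses.MotivatedImpliesAlgebraicAV`, published modulo X = `Ring2.AbelianAll.LefschetzBCompactPencils`), gen 43.
`HC_CM` (`Theses.RankFourFaces.CMAbelianHodge`) does not occur in this file; nothing here proves a case of the Hodge
conjecture; no binder of `BINDER-OWNERS.md` is discharged; row b05 and X stay OPEN and are not asserted.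

THE POINT. André's own reductions («il est loisible de remplacer `S` par un revêtement fini étale», §5.1 / Cor. 5.1 /
§5.3) and every monodromy argument on the β-column pass from a pencil `f : 𝒳 ⟶ S` to its base change
`f' : 𝒳 ×_S S' ⟶ S'` along a connected finite étale cover `g : S' ⟶ S`. On the tree's carriers the nodes X = (5∀),
(5), (β′) quantify over `IsCompactAbelianPencil`, whose fields demand a smooth PROJECTIVE (geometrically irreducible)
base curve and total space; the Literature's base-change lemma `IsSmoothProjectiveFamily.familyPullback_snd` gives the
family but not these two fields. This file supplies them, fact-free, from Mathlib's morphism classes: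

* §1 `isSmoothProjective_of_isFinite_of_etale` — **a finite étale cover `S' → S` with `S'(ℂ)` connected of a smooth
  projective `m`-fold is a smooth projective `m`-fold** (smooth: composition; projective: proper and finite over
  `S ↪ ℙᴺ`, Görtz–Wedhorn 13.84 = the tree's `isProjectiveOver_of_isFinite`; geometrically irreducible: smooth with
  connected complex points, the tree's `geometricallyIrreducible_of_connectedSpace_complexPoints`).
* §2 `isSmoothProjective_familyPullback` — **the total space `𝒳 ×_S S'` of the base change of a smooth projective family
  with projective total space along such a cover is a smooth projective `(n+m)`-fold** (finite over `𝒳 ↪ ℙᴹ`;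
  irreducible by the tree's `irreducibleSpace_of_isSmoothProjectiveFamily`; integral over `ℂ` ⟹ geometrically integral).
* §3 `isCompactAbelianPencil_familyPullback_snd` — **compact abelian pencils pull back to compact abelian pencils**
  along connected finite étale covers of the base curve (the zero section pulls back; fibres are unchanged,
  `fiberOverFamilyPullbackIso`).
* §4 `standardConjectureBStar_of_familyPullback` — **`B⋆` of the total space of a pencil DESCENDS from the pulled-back
  pencil**: `(∀ η', B⋆(𝒳 ×_S S', η')) ⟹ ∀ η, B⋆(𝒳, η)`, because `𝒳 ×_S S' ⟶ 𝒳` is finite, hence surjective onto the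
  irreducible `𝒳`... precisely: it is the base change of the surjective `g`, and gen 41's descent of `B⋆` along
  surjections (`standardConjectureBStar_of_surjective_of_forall`, Arapura Cor. 1.2 / Lemma 4.2 on the carriers)
  applies. So node X may be checked AFTER any connected finite étale base change (level structures, killing a finite
  monodromy quotient), pencil by pencil: `lefschetzB_pencil_of_familyPullback`.

HONEST COLUMN. No definition, no named fact, no sorry. §1–§3 are sorites of scheme theory (EGA II 5.5.5 / 6.1.11,
Görtz–Wedhorn I 13.84, SGA 1 I 9) on the tree's carriers; §4 is a kernel implication whose hypothesis (B⋆ upstairs) is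
NOT asserted. The CONVERSE of §4 (B⋆ downstairs ⟹ B⋆ upstairs) is not claimed and not known in general.
References: GortzWedhorn2020 (Thm. 13.84, Cor. 13.72, Prop. 5.51), SGA1 (Exp. I §9, Exp. XII Prop. 2.4),
Hartshorne1977 (II §4, Ex. 4.9), Arapura2006 (§1 Cor. 1.2, §4 Lemma 4.2), Andre1996Motifs (§5.1, Cor. 5.1, §5.3:
«remplacer S par un revêtement fini étale»), MumfordGIT (Thm. 6.14: abelian schemes over curves).
-/

noncomputable section

-- every declaration of this problem lives in `Summit.HodgeConjecture.HodgeConjecture.…` (summit = sub-problem)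
set_option linter.dupNamespace false

open CategoryTheory CategoryTheory.Limits AlgebraicGeometry MonoidalCategory
open _root_.Topology
open Literature.AlgebraicGeometry Literature.AlgebraicGeometry.Motives Literature.AlgebraicGeometry.HodgeTheory

namespace Summit.HodgeConjecture.HodgeConjecture.Theorems

universe u

/-! ## §1 Connected finite étale covers of smooth projective varieties are smooth projective -/

/-- **A finite étale cover with connected complex points of a smooth projective complex `m`-fold is a smooth projective
`m`-fold.** `S'` is smooth of relative dimension `0 + m` over `ℂ` (composition `S' → S → Spec ℂ`); proper (finite over
the proper `S`) and finite over `ℙᴺ` through `S ↪ ℙᴺ`, hence projective (Görtz–Wedhorn I Thm. 13.84 with Cor. 13.72,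
the tree's `isProjectiveOver_of_isFinite`); smooth with `S'(ℂ)` connected, hence geometrically irreducible
(`geometricallyIrreducible_of_connectedSpace_complexPoints`). [cite: GortzWedhorn2020, Thm. 13.84 (2) and Cor. 13.72]
[cite: SGA1, Exp. XII Prop. 2.4] -/
theorem isSmoothProjective_of_isFinite_of_etale {m : ℕ} {S S' : SchemeOver ℂ} (hS : IsSmoothProjective m S)
    (g : S' ⟶ S) [IsFinite g.left] [Etale g.left] [ConnectedSpace (ComplexPoints S')] :
    IsSmoothProjective m S' := by
  haveI := hS.smoothOfRelativeDimension
  -- smooth of relative dimension `m`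
  haveI hg0 : SmoothOfRelativeDimension 0 g.left := inferInstance
  haveI hS'd : SmoothOfRelativeDimension m S'.hom := by
    have h : SmoothOfRelativeDimension (0 + m) (g.left ≫ S.hom) := inferInstance
    rw [Over.w] at h
    simpa using h
  -- projective over `ℂ`
  have hproj : IsProjectiveOver S' := by
    haveI : IsProper S.hom := hS.isProjectiveOver.isProper
    obtain ⟨N, ι, hι⟩ := hS.isProjectiveOver
    haveI := hι
    haveI : IsProper S'.hom := by
      rw [← Over.w g]
      infer_instance
    haveI : IsFinite (g ≫ ι).left := by
      rw [Over.comp_left]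
      infer_instance
    exact isProjectiveOver_of_isFinite (g ≫ ι)
  -- geometrically irreducible
  haveI : GeometricallyIrreducible S'.hom := geometricallyIrreducible_of_connectedSpace_complexPoints m
  exact ⟨hS'd, hproj, inferInstance⟩

/-! ## §2 The total space of the base-changed family is smooth projective -/

/-- **The total space `𝒳 ×_S S'` of the base change of a smooth projective family `f : 𝒳 ⟶ S` of relative dimension
`n`, with projective total space, over a smooth projective `m`-fold `S`, along a finite étale `g : S' ⟶ S` with `S'(ℂ)`
connected, is a smooth projective `(n+m)`-fold.** Smooth of relative dimension `n + m` (`𝒳 ×_S S' → S' → Spec ℂ`);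
proper and finite over `𝒳 ↪ ℙᴹ` (base change of the finite `g`), hence projective (`isProjectiveOver_of_isFinite`);
irreducible (a smooth projective family over the irreducible `S'`, `irreducibleSpace_of_isSmoothProjectiveFamily`) and
reduced, i.e. integral, hence geometrically integral over the algebraically closed `ℂ` (`geometricallyIntegral_of_isAlgClosed`).
[cite: GortzWedhorn2020, Thm. 13.84 (2), Cor. 13.72 and Prop. 5.51] [cite: Liu2002, Ch. 4 Prop. 3.8] -/
theorem isSmoothProjective_familyPullback {n m : ℕ} {𝒳 S S' : SchemeOver ℂ} {f : 𝒳 ⟶ S}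
    (hS : IsSmoothProjective m S) (hf : IsSmoothProjectiveFamily f n) (h𝒳 : IsProjectiveOver 𝒳)
    (g : S' ⟶ S) [IsFinite g.left] [Etale g.left] [ConnectedSpace (ComplexPoints S')] :
    IsSmoothProjective (n + m) (familyPullback f g) := by
  have hS' := isSmoothProjective_of_isFinite_of_etale hS g
  haveI := hS'.smoothOfRelativeDimension
  have hf' : IsSmoothProjectiveFamily (familyPullback.snd f g) n := hf.familyPullback_snd g
  haveI := hf'.smoothOfRelativeDimension
  haveI hXd : SmoothOfRelativeDimension (n + m) (familyPullback f g).hom := by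
    rw [← Over.w (familyPullback.snd f g)]
    infer_instance
  -- projective: finite over `𝒳 ↪ ℙᴹ`
  have hproj : IsProjectiveOver (familyPullback f g) := by
    haveI : IsProper 𝒳.hom := h𝒳.isProper
    obtain ⟨M, ι, hι⟩ := h𝒳
    haveI := hι
    haveI hfst : IsFinite (pullback.fst f.left g.left) :=
      MorphismProperty.pullback_fst (P := @IsFinite) _ _ ‹IsFinite g.left›
    haveI : IsFinite (familyPullback.fst f g).left := by
      rw [familyPullback.fst_left]
      exact hfst
    haveI : IsProper (familyPullback.fst f g).left := inferInstance
    haveI : IsProper (familyPullback f g).hom := by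
      rw [← Over.w (familyPullback.fst f g)]
      infer_instance
    haveI : IsFinite (familyPullback.fst f g ≫ ι).left := by
      rw [Over.comp_left]
      infer_instance
    exact isProjectiveOver_of_isFinite (familyPullback.fst f g ≫ ι)
  -- geometrically irreducible
  haveI : Smooth S'.hom := SmoothOfRelativeDimension.smooth m _
  haveI : IrreducibleSpace S'.left := irreducibleSpace_left_of_connectedSpace_complexPoints
  haveI : LocallyOfFiniteType S'.hom := inferInstance
  haveI : IrreducibleSpace (familyPullback f g).left :=
    irreducibleSpace_of_isSmoothProjectiveFamily (familyPullback.snd f g) hf'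
  haveI : Smooth (familyPullback f g).hom := SmoothOfRelativeDimension.smooth (n + m) _
  haveI : IsReduced (familyPullback f g).left := Motives.isReduced_of_smooth_over_field (familyPullback f g).hom
  haveI : IsIntegral (familyPullback f g).left := isIntegral_of_irreducibleSpace_of_isReduced _
  haveI := geometricallyIntegral_of_isAlgClosed (familyPullback f g).hom
  exact ⟨hXd, hproj, inferInstance⟩

/-! ## §3 Compact abelian pencils pull back to compact abelian pencils -/

/-- **The base change of a compact pencil of abelian `d`-folds along a finite étale cover of the base curve with connected
complex points is a compact pencil of abelian `d`-folds**: the zero section pulls back (`(g ≫ e, 𝟙) : S' → 𝒳 ×_S S'`), the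
new base is a smooth projective curve (§1), the new total space a smooth projective `(d+1)`-fold (§2), the family is
smooth projective of relative dimension `d` (`IsSmoothProjectiveFamily.familyPullback_snd`), and the fibre over `s'` is
the abelian fibre over `g(s')` (`fiberOverFamilyPullbackIso`). [cite: MumfordGIT, Thm. 6.14] [cite: Hartshorne1977, II §3 (base extension)] -/
theorem isCompactAbelianPencil_familyPullback_snd {d : ℕ} {𝒳 S S' : SchemeOver ℂ} {f : 𝒳 ⟶ S}
    (hf : IsCompactAbelianPencil f d) (g : S' ⟶ S) [IsFinite g.left] [Etale g.left]
    [ConnectedSpace (ComplexPoints S')] : IsCompactAbelianPencil (familyPullback.snd f g) d := by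
  obtain ⟨e, he⟩ := hf.exists_section
  have he' : e.left ≫ f.left = 𝟙 S.left := by
    rw [← Over.comp_left, he]
    rfl
  -- the pulled-back section
  let e' : S' ⟶ familyPullback f g :=
    Over.homMk (pullback.lift (g.left ≫ e.left) (𝟙 S'.left)
      (by rw [Category.assoc, he', Category.comp_id, Category.id_comp])) (by
        change pullback.lift (g.left ≫ e.left) (𝟙 S'.left) _ ≫ pullback.fst f.left g.left ≫ 𝒳.hom = S'.hom
        rw [pullback.lift_fst_assoc, Category.assoc, Over.w e, Over.w g])
  refine IsCompactAbelianPencil.of_section e' ?_ (isSmoothProjective_of_isFinite_of_etale hf.isSmoothProjective_base g)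
    (isSmoothProjective_familyPullback hf.isSmoothProjective_base hf.isSmoothProjectiveFamily
      hf.isSmoothProjective_total.isProjectiveOver g)
    (hf.isSmoothProjectiveFamily.familyPullback_snd g) fun s' ↦ ?_
  · ext : 1
    change pullback.lift (g.left ≫ e.left) (𝟙 S'.left) _ ≫ pullback.snd f.left g.left = 𝟙 S'.left
    rw [pullback.lift_snd]
  · obtain ⟨A, ⟨eA⟩⟩ := hf.exists_abelianVariety_fiber (AlgPoints.map g s')
    exact ⟨A, ⟨eA ≪≫ (fiberOverFamilyPullbackIso f g s').symm⟩⟩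

/-! ## §4 `B⋆` of the total space descends from the pulled-back pencil -/

/-- **`B⋆` descends along the base change**: for a smooth projective family `f : 𝒳 ⟶ S` of relative dimension `n` with
smooth projective total `(n+m)`-fold `𝒳` over a smooth projective `m`-fold `S`, and a finite étale `g : S' ⟶ S` with
`S'(ℂ)` connected and NON-EMPTY... (non-emptiness is automatic: `ConnectedSpace`), if `B⋆(𝒳 ×_S S', η')` holds for every
`η'` then `B⋆(𝒳, η)` holds for every `η`: `𝒳 ×_S S' ⟶ 𝒳` is the base change of `g`, which is surjective (finite étale
onto the irreducible `S`, `surjective_of_isFinite_of_etale_of_irreducible`), so it is surjective, and gen 41's descent of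
`B⋆` along surjections of smooth projective varieties applies (`standardConjectureBStar_of_surjective_of_forall`).
[cite: Arapura2006, §1 Cor. 1.2 and §4 Lemma 4.2] [cite: Kleiman1968AlgebraicCycles, Cor. 2.5] -/
theorem standardConjectureBStar_of_familyPullback {n m : ℕ} {𝒳 S S' : SchemeOver ℂ} {f : 𝒳 ⟶ S}
    (hS : IsSmoothProjective m S) (hf : IsSmoothProjectiveFamily f n) (h𝒳 : IsSmoothProjective (n + m) 𝒳)
    (g : S' ⟶ S) [IsFinite g.left] [Etale g.left] [ConnectedSpace (ComplexPoints S')]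
    (hB : ∀ η' : complexBetti (familyPullback f g) 2, StandardConjectureBStar (n + m) (familyPullback f g) η')
    (η : complexBetti 𝒳 2) : StandardConjectureBStar (n + m) 𝒳 η := by
  have hX' := isSmoothProjective_familyPullback hS hf h𝒳.isProjectiveOver g
  -- `g` is surjective: finite étale from a non-empty scheme onto the irreducible `S`
  haveI := hS.smoothOfRelativeDimension
  haveI hS'd : SmoothOfRelativeDimension m S'.hom := by
    have h : SmoothOfRelativeDimension (0 + m) (g.left ≫ S.hom) := inferInstance
    rw [Over.w] at h
    simpa using h
  haveI : Smooth S'.hom := SmoothOfRelativeDimension.smooth m _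
  haveI : IrreducibleSpace S'.left := irreducibleSpace_left_of_connectedSpace_complexPoints
  haveI : Nonempty S'.left := inferInstance
  haveI : IrreducibleSpace S.left := hS.irreducibleSpace
  haveI : Surjective g.left := surjective_of_isFinite_of_etale_of_irreducible g.left
  haveI : Surjective (familyPullback.fst f g).left := by
    rw [familyPullback.fst_left]
    exact MorphismProperty.pullback_fst (P := @Surjective) _ _ ‹Surjective g.left›
  exact standardConjectureBStar_of_surjective_of_forall hX' h𝒳 (familyPullback.fst f g) hB η

/-- **Node X, pencil by pencil, may be checked after a connected finite étale base change**: for a compact pencil of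
abelian `d`-folds `f : 𝒳 ⟶ S` and a finite étale `g : S' ⟶ S` with `S'(ℂ)` connected, `B⋆` in every polarisation for
the total space of the pulled-back pencil `𝒳 ×_S S' ⟶ S'` (again a compact abelian pencil, §3) gives `B⋆(𝒳, η)` for
every `η`. [cite: Andre1996Motifs, §6.3 Remarque 2 (p. 33) and §5.3 (p. 30)] [cite: Arapura2006, §4 Lemma 4.2] -/
theorem lefschetzB_pencil_of_familyPullback {d : ℕ} {𝒳 S S' : SchemeOver ℂ} {f : 𝒳 ⟶ S}
    (hf : IsCompactAbelianPencil f d) (g : S' ⟶ S) [IsFinite g.left] [Etale g.left]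
    [ConnectedSpace (ComplexPoints S')]
    (hB : ∀ η' : complexBetti (familyPullback f g) 2, StandardConjectureBStar (d + 1) (familyPullback f g) η')
    (η : complexBetti 𝒳 2) : StandardConjectureBStar (d + 1) 𝒳 η :=
  standardConjectureBStar_of_familyPullback hf.isSmoothProjective_base hf.isSmoothProjectiveFamily
    hf.isSmoothProjective_total g hB η

/-- **The graded node `(5∀)_d` is insensitive to connected finite étale base change, in the descending direction**:
if `B⋆` holds in every polarisation for the total space of SOME connected finite étale base change of each compact
pencil of abelian `d`-folds, then `(5∀)_d` (`Ring2.AbelianAll.LefschetzBCompactPencilsAtRelDim d`) holds.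
[cite: Andre1996Motifs, §6.3 Remarque 2 (p. 33)] -/
theorem lefschetzBCompactPencilsAtRelDim_of_forall_exists_familyPullback {d : ℕ}
    (h : ∀ ⦃𝒳 S : SchemeOver ℂ⦄ (f : 𝒳 ⟶ S), IsCompactAbelianPencil f d →
      ∃ (S' : SchemeOver ℂ) (g : S' ⟶ S) (_ : IsFinite g.left) (_ : Etale g.left)
        (_ : ConnectedSpace (ComplexPoints S')),
        ∀ η' : complexBetti (familyPullback f g) 2, StandardConjectureBStar (d + 1) (familyPullback f g) η') :
    Ring2.AbelianAll.LefschetzBCompactPencilsAtRelDim d := by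
  intro 𝒳 S f hf η
  obtain ⟨S', g, hg₁, hg₂, hS', hB⟩ := h f hf
  exact lefschetzB_pencil_of_familyPullback hf g hB η

end Summit.HodgeConjecture.HodgeConjecture.Theorems

end
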